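import Summits.BirchSwinnertonDyer.Rank1Residual.X2.NonsplitBDPExistsInt
import Summits.BirchSwinnertonDyer.Rank1Residual.X2.NonsplitHalvesOnTree
import HarnessLib

/-!
# O9 ∩ {non-split} over the WIDE receptacle `𝓞_{ℂ_p}⟦T⟧`, assembly half: `BSD(E,p)` at a Heegner datum
# FROM PRINT + THE TWO ♭ HALVES — the (b1) road with the residual c1 GONE (cell `bsd-eis`, seat
# `bsd-eis-k5-c4`; route `EisensteinPrimes`, crux 4 `BSDpOnCellC`, line b1: atoms c1 and c2¬split)

HONEST FRAMING (cell `bsd-eis`): theorems only; nothing booked; X2 stays CONSTRUCTION-SHAPED; no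
label moves. With `X2/NonsplitBDPExistsInt.lean` (the ♭ halves `NonsplitBDPValueOnTreeInt W p` (H2♭) /
`NonsplitIMCEqOnTreeInt W p` (H3♭) and `exists_isBDPLFunctionInt_of_hsieh2014_of_classX2`: H1♭ at every X2
datum from Hsieh 2014 Thm. 1 (PUB) and the tree theorem `X11b.lambdaSupplyAt`, NO residual):

* §3 pointwise: **`imcWaldspurgerOnTreeAt_of_intHalves_of_not_split_of_rankOne`** (CTL₀ from the
  control theorem p398508 ∧ H3♭ ∧ H2♭ ⟹ the composite, via `X11b.R1.imcWaldspurgerOnTreeAt_of_intHalves`,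
  gen 23) and **`bsdp_of_cellCNonsplitNotGV_of_intHalves`** (p404431's `bsdp_of_cellCNonsplitNotGV_of_halves`
  over the wide receptacle).
* §4 the three assemblies of p404695 with the binder `hres : HsiehFrameResidualAt W p` GONE and `h2`/`h3`
  read ♭: **`bsdp_of_cellCNonsplitNotGV_of_hsieh2014_of_intHalvesOnTree`** (ψ even),
  **`bsdp_of_cellC_of_not_split_of_hsieh2014_of_intHalvesOnTree_of_partner`** (either parity, partner's
  `PPartRankZero`), **`bsdp_of_cellC_of_not_split_of_hsieh2014_of_intHalvesOnTree_of_mazurMainConjectureAt`**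
  (partner in main-conjecture form).

So on ALL of O9 ∩ {non-split} (2 552 + 2 830 @3, 93 + 178 @5, 17 + 7 @7 classes) the residual inputs
read: {Hsieh 2014 Thm. 1 (PUB), H2♭, H3♭} + [ψ odd only] the partner's rank-zero MC — ONE NAMED
RESIDUAL FEWER than v1 (c1 eliminated), at the price of reading H2/H3 over `𝓞_{ℂ_p}`-frames.
CONDITIONAL on every listed binder; nothing booked; no label change.

References: [Hsieh2014] Thm. 1 (arXiv:1112.1580 pp. 3–4); [Castella2018] Thm. 2.3, Thm. 3.2, §5
(arXiv:1704.06608 pp. 5, 9, 12); [KellerYin2024] Thm. D (PRE); [CastellaEtAl2021] Thm. 5.3.1;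
[SteinWuthrich2013] Thm. 6.1; [Miller2011LMS] Def. 1.1.
-/

set_option autoImplicit false

noncomputable section

open scoped Classical MatrixGroups ModularForm

open CongruenceSubgroup WeierstrassCurve NumberField IsDedekindDomain Field PowerSeries
  Literature.NumberTheory.EllipticCurves Literature.NumberTheory.EllipticCurves.GreenbergSelmer
  Literature.NumberTheory.EllipticCurves.ModularForms
  Literature.NumberTheory.EllipticCurves.Rank1Residual
  Literature.NumberTheory.EllipticCurves.Rank1Residual.Typed
  Literature.NumberTheory.EllipticCurves.GreenbergVatsal2000
  Literature.NumberTheory.EllipticCurves.Wuthrich2014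
  Literature.NumberTheory.EllipticCurves.SteinWuthrich2013
  Literature.NumberTheory.GaloisRepresentations Literature.NumberTheory.GaloisCohomology
  Literature.NumberTheory.Automorphic
  Summit.BirchSwinnertonDyer.Rank1Residual.X11b.AcSelmer
  Summit.BirchSwinnertonDyer.Rank1Residual.X11b.Halves
  Summit.BirchSwinnertonDyer.Rank1Residual.X11b

namespace Summit.BirchSwinnertonDyer.Rank1Residual.X2

/-! ### §3 Pointwise over the wide receptacle -/

section Pointwise

variable (W : WeierstrassCurve ℚ) [W.IsElliptic] [W.IsGloballyMinimal] (p : ℕ) [Fact p.Prime]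

/-- **♭-HALVES ⟹ the composite input, at a NON-SPLIT rank-one multiplicative pair (any image of
`E[p]`).** `imcWaldspurgerOnTreeAt_of_halves_of_not_split_of_rankOne` (p404431) over the wide receptacle:
with the control theorem `controlOnTreeAt_of_not_split_of_rankOne` (p398508) supplying CTL₀'s
`HasCharValuationAt n` and `Mult` supplying `p ∤ a_p(E)`: for every `Q ∈ 𝓞_{ℂ_p}⟦T⟧`, H3♭
`R1.IMCEqIntAt W p κ 𝔭 γ Q` ∧ H2♭ `R1.BDPValueAtOneIntAt W p (embAt K p 𝔭) P Q (a_p)` ⟹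
`IMCWaldspurgerOnTreeAt p κ 𝔭 γ (embAt K p 𝔭) P` (`X11b.R1.imcWaldspurgerOnTreeAt_of_intHalves`, gen 23).
CONDITIONAL on the cited facts of the control theorem and on the two ♭ halves.
[cite: Castella2018, §5 (5.1) (arXiv:1704.06608 p. 12)] [cite: Castella2018Erratum, Thm. 1.1 (p. 1) (shape only)] -/
theorem imcWaldspurgerOnTreeAt_of_intHalves_of_not_split_of_rankOne
    (hGZK : rank_eq_analyticRank_of_analyticRank_le_one) (hnf : exists_isNewformOf)
    (hPT : ∀ (K : Type) [Field K] [NumberField K], poitouTate_selmerStructure_duality K)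
    (hPT2 : ∀ (K : Type) [Field K] [NumberField K], poitouTate_sha_tateDual K)
    (hEP : ∀ (K : Type) [Field K] [NumberField K] (v : HeightOneSpectrum (𝓞 K)),
      localEulerPoincareCharacteristic (v.adicCompletion K))
    (hcd : fieldCdLE_two_of_numberField)
    (hBr : ∀ (K : Type) [Field K] [NumberField K] (p : ℕ) [Fact p.Prime],
      ZpExtension.decomp_not_le_kerSubgroup_of_isAnticyclotomic K p)
    (hp2 : p ≠ 2) (hmult : Mult W p) (hns : ¬ W.HasSplitMultiplicativeReductionAtPrime p)
    (hr : W.analyticRank = 1) {K : Type} [Field K] [NumberField K] (hK : IsImaginaryQuadratic K)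
    (hsplit : SplitsIn K p) (hLt : (W.quadraticTwist (NumberField.discr K : ℚ)).entireLFunction 1 ≠ 0)
    (P : (W.baseChange K).toAffine.Point) (hPinf : ¬ IsOfFinAddOrder P)
    (κ : ZpExtension K p) (hκ : κ.IsAnticyclotomic) (γ : absoluteGaloisGroup K)
    [Fact (κ.IsTopGenerator γ)] (𝔭 : HeightOneSpectrum (𝓞 K))
    (h𝔭 : ((p : ℕ) : 𝓞 K) ∈ 𝔭.asIdeal) (he : 𝔭.asIdeal.ramificationIdx (𝓞 ℚ) = 1)
    (hf : 𝔭.asIdeal.inertiaDeg (𝓞 ℚ) = 1) (Q : PowerSeries 𝓞_ℂ_[p])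
    (h3 : R1.IMCEqIntAt W p κ 𝔭 γ Q)
    (h2 : R1.BDPValueAtOneIntAt W p (embAt K p 𝔭 h𝔭 he hf) P Q (W.LFunction p)) :
    IMCWaldspurgerOnTreeAt p κ 𝔭 γ (embAt K p 𝔭 h𝔭 he hf) P := by
  haveI : NeZero (W.conductorNorm ℤ) := ⟨(W.conductorNorm_pos_holds).ne'⟩
  obtain ⟨f, hfW⟩ := hnf W
  obtain ⟨n, hn, -⟩ := controlOnTreeAt_of_not_split_of_rankOne W p hGZK hnf hPT hPT2 hEP hcd hBr hp2
    hmult hns hr hK hsplit hLt P hPinf κ hκ γ 𝔭 h𝔭 he hf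
  exact R1.imcWaldspurgerOnTreeAt_of_intHalves hn h3 (R1.not_dvd_lFunction_of_mult hfW hmult) h2

/-- **O9 sub-cell `CellCNonsplitNotGV` at a Heegner datum FROM THE TWO ♭ HALVES** —
`bsdp_of_cellCNonsplitNotGV_of_halves` (p404431) over the wide receptacle: `BSD(E,p)` from the
PUBLISHED facts of `X2/RankOneChain`, GZK/modularity, the FIVE cited cohomological facts, and — for SOME
`Q ∈ 𝓞_{ℂ_p}⟦T⟧` — H3♭ `R1.IMCEqIntAt W p κ 𝔭 γ Q` (Keller–Yin Thm. D shape, PREPRINT) and H2♭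
`R1.BDPValueAtOneIntAt W p (embAt K p 𝔭) P Q (a_p)` (Castella JIMJ 17 Thm. 2.11 shape). The control and
Tamagawa links are theorems (p398508 / p398550). CONDITIONAL; nothing booked. [claim: KellerYin2024, status: under-review]
[cite: CastellaEtAl2021, Thm. 5.3.1] [cite: Castella2018, Thm. 2.3, Thm. 3.2 and §5] [cite: Miller2011LMS, Def. 1.1] -/
theorem bsdp_of_cellCNonsplitNotGV_of_intHalves
    (hGV : lambdaMu_multiplicative_of_gvPar) (hWu : thm16_charIdeal_dvd_multiplicative_of_reducible)
    (hJs : thm61_splitMultiplicative) (hJn : thm61_nonsplitMultiplicative)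
    (hHs : exists_isSplitMultCanonical) (hHn : exists_isMultCanonical)
    (hpar : nonempty_modularParametrizationData)
    (hGS : ∀ (W : WeierstrassCurve ℚ) [W.IsElliptic] [W.IsGloballyMinimal] (p : ℕ) [Fact p.Prime],
      greenberg_stevens (W := W) (p := p))
    (hnf : exists_isNewformOf)
    (hPT : ∀ (K : Type) [Field K] [NumberField K], poitouTate_selmerStructure_duality K)
    (hPT2 : ∀ (K : Type) [Field K] [NumberField K], poitouTate_sha_tateDual K)
    (hEP : ∀ (K : Type) [Field K] [NumberField K] (v : HeightOneSpectrum (𝓞 K)),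
      localEulerPoincareCharacteristic (v.adicCompletion K))
    (hcd : fieldCdLE_two_of_numberField)
    (hBr : ∀ (K : Type) [Field K] [NumberField K] (p : ℕ) [Fact p.Prime],
      ZpExtension.decomp_not_le_kerSubgroup_of_isAnticyclotomic K p)
    (N : ℕ) [NeZero N] (K : Type) [Field K] [NumberField K]
    (Dt : ModularParametrizationData W N) (H : HeegnerDatum N (NumberField.discr K)) (ι : K →+* ℂ)
    (P : (W.baseChange K).toAffine.Point)
    (hGZ : gross_zagier N W K) (hKo : kolyvagin N W K)
    (hGZK : rank_eq_analyticRank_of_analyticRank_le_one)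
    (hc : CellCNonsplitNotGV W p) (hN : W.conductorNorm ℤ = N) (hK : IsImaginaryQuadratic K)
    (hd4 : NumberField.discr K < -4) (hHN : SatisfiesHeegnerHypothesis N K)
    (hsplit : SatisfiesHeegnerHypothesis p K)
    (hP : WeierstrassCurve.Affine.Point.map ι.toRatAlgHom P = heegnerPointComplex Dt H)
    (hPinf : ¬ IsOfFinAddOrder P) (hcM : ¬ (p : ℤ) ∣ Dt.c)
    (hLt : (W.quadraticTwist (NumberField.discr K : ℚ)).entireLFunction 1 ≠ 0)
    (Wd : WeierstrassCurve ℚ) [Wd.IsElliptic] [Wd.IsGloballyMinimal] (Cd : VariableChange ℚ)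
    (hWd : Cd • W.quadraticTwist (NumberField.discr K : ℚ) = Wd)
    (htam : padicValNat p Wd.tamagawaProduct = padicValNat p W.tamagawaProduct)
    (hu : padicValRat p (Cd.u : ℚ) = 0)
    (htamK : padicValNat p (W.baseChange K).tamagawaProduct = 2 * padicValNat p W.tamagawaProduct)
    (κ : ZpExtension K p) (hκ : κ.IsAnticyclotomic) (γ : absoluteGaloisGroup K)
    [Fact (κ.IsTopGenerator γ)] (𝔭 : HeightOneSpectrum (𝓞 K))
    (h𝔭 : ((p : ℕ) : 𝓞 K) ∈ 𝔭.asIdeal) (he : 𝔭.asIdeal.ramificationIdx (𝓞 ℚ) = 1)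
    (hf : 𝔭.asIdeal.inertiaDeg (𝓞 ℚ) = 1) (Q : PowerSeries 𝓞_ℂ_[p])
    (h3 : R1.IMCEqIntAt W p κ 𝔭 γ Q)
    (h2 : R1.BDPValueAtOneIntAt W p (embAt K p 𝔭 h𝔭 he hf) P Q (W.LFunction p)) : BSDp W p :=
  bsdp_of_cellCNonsplitNotGV_of_imcWaldspurgerOnTree hGV hWu hJs hJn hHs hHn hpar hGS hnf hPT hPT2
    hEP hcd hBr W p N K Dt H ι P hGZ hKo hGZK hc hN hK hd4 hHN hsplit hP hPinf hcM hLt Wd Cd hWd htam hu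
    htamK κ hκ γ 𝔭 h𝔭 he hf
    (imcWaldspurgerOnTreeAt_of_intHalves_of_not_split_of_rankOne W p hGZK hnf hPT hPT2 hEP hcd hBr
      hc.1.2.1 hc.1.2.2.2 hc.2.1 hc.1.1 hK (hsplit p Fact.out dvd_rfl) hLt P hPinf κ hκ γ 𝔭 h𝔭 he hf Q
      h3 h2)

end Pointwise

/-! ### §4 The assemblies of p404695 with the residual GONE and the halves read ♭ -/

section Assembly

variable (W : WeierstrassCurve ℚ) [W.IsElliptic] [W.IsGloballyMinimal] (p : ℕ) [Fact p.Prime]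

/-- **O9 sub-cell `CellCNonsplitNotGV` at a Heegner datum FROM PRINT + THE TWO ♭ HALVES — NO
RESIDUAL.** `bsdp_of_cellCNonsplitNotGV_of_hsieh2014_of_halvesOnTree` (p404695) with the binder
`hres : HsiehFrameResidualAt W p` REMOVED: `BSD(E,p)` at a Heegner datum of a ψ-even non-split X2c pair
from the PUBLISHED facts of `X2/RankOneChain` (`hGV … hGS`), GZK / modularity (`hGZK`, `hnf`, `hGZ`,
`hKo`), the FIVE cited cohomological facts of the control theorem (`hPT`, `hPT2`, `hEP`, `hcd`, `hBr`),
Hsieh 2014 Thm. 1 (`hH`, PUB), H2♭ (`NonsplitBDPValueOnTreeInt W p`) and H3♭ (`NonsplitIMCEqOnTreeInt W p`).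
The ♭-frame is PRODUCED: `ι₀ : ℚ̄_p ≃ ℂ` exists (Steinitz), the degree-one `𝔭` of the datum is induced
by `ι₀` or `ι₀ ∘ conj` (`X11b.exists_datum_forall_mem_iff`), §2 gives `(Ω_K, Ω_p, Q)` there from Hsieh's
fact and `X11b.lambdaSupplyAt` alone, H2♭/H3♭ are instantiated at it, and §3 concludes. Residual inputs
of the ψ-even non-split O9 cell: {Hsieh 2014 Thm. 1 (PUB), H2♭, H3♭} — the named residual c1 of v1 is
not among them. CONDITIONAL on every listed binder; nothing booked; no label change.
[cite: Hsieh2014, Thm. 1 (arXiv:1112.1580 pp. 3–4)] [claim: KellerYin2024, status: under-review]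
[cite: CastellaEtAl2021, Thm. 5.3.1] [cite: Castella2018, Thm. 2.3, Thm. 3.2 and §5 (arXiv:1704.06608 pp. 5, 9, 12)]
[cite: Miller2011LMS, Def. 1.1] -/
theorem bsdp_of_cellCNonsplitNotGV_of_hsieh2014_of_intHalvesOnTree
    (hGV : lambdaMu_multiplicative_of_gvPar) (hWu : thm16_charIdeal_dvd_multiplicative_of_reducible)
    (hJs : thm61_splitMultiplicative) (hJn : thm61_nonsplitMultiplicative)
    (hHs : exists_isSplitMultCanonical) (hHn : exists_isMultCanonical)
    (hpar : nonempty_modularParametrizationData)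
    (hGS : ∀ (W : WeierstrassCurve ℚ) [W.IsElliptic] [W.IsGloballyMinimal] (p : ℕ) [Fact p.Prime],
      greenberg_stevens (W := W) (p := p))
    (hnf : exists_isNewformOf)
    (hPT : ∀ (K : Type) [Field K] [NumberField K], poitouTate_selmerStructure_duality K)
    (hPT2 : ∀ (K : Type) [Field K] [NumberField K], poitouTate_sha_tateDual K)
    (hEP : ∀ (K : Type) [Field K] [NumberField K] (v : HeightOneSpectrum (𝓞 K)),
      localEulerPoincareCharacteristic (v.adicCompletion K))
    (hcd : fieldCdLE_two_of_numberField)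
    (hBr : ∀ (K : Type) [Field K] [NumberField K] (p : ℕ) [Fact p.Prime],
      ZpExtension.decomp_not_le_kerSubgroup_of_isAnticyclotomic K p)
    (hH : hsieh2014_exists_anticyclotomicPAdicLFunction)
    (N : ℕ) [NeZero N] (K : Type) [Field K] [NumberField K]
    (Dt : ModularParametrizationData W N) (H : HeegnerDatum N (NumberField.discr K)) (ι : K →+* ℂ)
    (P : (W.baseChange K).toAffine.Point)
    (hGZ : gross_zagier N W K) (hKo : kolyvagin N W K)
    (hGZK : rank_eq_analyticRank_of_analyticRank_le_one)
    (hc : CellCNonsplitNotGV W p) (hN : W.conductorNorm ℤ = N) (hK : IsImaginaryQuadratic K)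
    (hd4 : NumberField.discr K < -4) (hHN : SatisfiesHeegnerHypothesis N K)
    (hsplit : SatisfiesHeegnerHypothesis p K)
    (hP : WeierstrassCurve.Affine.Point.map ι.toRatAlgHom P = heegnerPointComplex Dt H)
    (hPinf : ¬ IsOfFinAddOrder P) (hcM : ¬ (p : ℤ) ∣ Dt.c)
    (hLt : (W.quadraticTwist (NumberField.discr K : ℚ)).entireLFunction 1 ≠ 0)
    (Wd : WeierstrassCurve ℚ) [Wd.IsElliptic] [Wd.IsGloballyMinimal] (Cd : VariableChange ℚ)
    (hWd : Cd • W.quadraticTwist (NumberField.discr K : ℚ) = Wd)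
    (htam : padicValNat p Wd.tamagawaProduct = padicValNat p W.tamagawaProduct)
    (hu : padicValRat p (Cd.u : ℚ) = 0)
    (htamK : padicValNat p (W.baseChange K).tamagawaProduct = 2 * padicValNat p W.tamagawaProduct)
    (κ : ZpExtension K p) (hκ : κ.IsAnticyclotomic) (γ : Field.absoluteGaloisGroup K)
    [Fact (κ.IsTopGenerator γ)] (𝔭 : HeightOneSpectrum (𝓞 K))
    (h𝔭 : ((p : ℕ) : 𝓞 K) ∈ 𝔭.asIdeal) (he : 𝔭.asIdeal.ramificationIdx (𝓞 ℚ) = 1)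
    (hf : 𝔭.asIdeal.inertiaDeg (𝓞 ℚ) = 1)
    (h2 : NonsplitBDPValueOnTreeInt W p) (h3 : NonsplitIMCEqOnTreeInt W p) : BSDp W p := by
  subst hN
  obtain ⟨f, hfW⟩ := hnf W
  obtain ⟨ι₀⟩ := PadicAlgCl.nonempty_ringEquiv_complex p
  obtain ⟨ι', -, hι'⟩ := X11b.exists_datum_forall_mem_iff p ι₀ hK h𝔭
  obtain ⟨ΩK, Ωp, Q, hΩK, hΩp, hQ⟩ := exists_isBDPLFunctionInt_of_hsieh2014_of_classX2 W p hH ι' 𝔭 κ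
    γ hfW hc.1.2 rfl hK hHN h𝔭 hι' hκ Fact.out
  exact bsdp_of_cellCNonsplitNotGV_of_intHalves W p hGV hWu hJs hJn hHs hHn hpar hGS hnf hPT hPT2 hEP
    hcd hBr (W.conductorNorm ℤ) K Dt H ι P hGZ hKo hGZK hc rfl hK hd4 hHN hsplit hP hPinf hcM hLt Wd
    Cd hWd htam hu htamK κ hκ γ 𝔭 h𝔭 he hf Q
    (h3 (W.conductorNorm ℤ) K Dt H ι P hc.1 hc.2.1 rfl hK hd4 hHN hLt hP hcM hPinf κ hκ γ 𝔭 h𝔭 he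
      hf f hfW ι' hι' ΩK Ωp Q hΩK hΩp hQ)
    (h2 (W.conductorNorm ℤ) K Dt H ι P hc.1 hc.2.1 rfl hK hd4 hHN hLt hP hcM hPinf κ hκ γ 𝔭 h𝔭 he
      hf f hfW ι' hι' ΩK Ωp Q hΩK hΩp hQ)

/-- **Either parity: O9 ∩ {non-split} at a Heegner datum FROM PRINT + THE TWO ♭ HALVES + the partner's
rank-zero `p`-part — NO RESIDUAL.** `bsdp_of_cellC_of_not_split_of_hsieh2014_of_halvesOnTree_of_partner`
(p404695) with the binder `hres` REMOVED: for a rank-one X2 pair at a NON-split `p` of EITHER parity,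
`BSD(E,p)` from Hsieh 2014 Thm. 1 (`hH`), H2♭ `NonsplitBDPValueOnTreeInt W p`, H3♭
`NonsplitIMCEqOnTreeInt W p`, the published / cited facts, and the partner's `PPartRankZero Wd p`
(`Wd` = the CGLS twist `E^{d_K}`, rank `0`, non-split X2 — CLOSED in X2a when ψ is even; Mazur's main
conjecture at a non-split Eisenstein `p ‖ N` when ψ is odd). CONDITIONAL on every listed binder;
nothing booked. [cite: Hsieh2014, Thm. 1 (arXiv:1112.1580 pp. 3–4)] [claim: KellerYin2024, status: under-review]
[cite: Castella2018, Thm. 2.3, Thm. 3.2 and §5 (arXiv:1704.06608 pp. 5, 9, 12)] [cite: Miller2011LMS, Def. 1.1] -/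
theorem bsdp_of_cellC_of_not_split_of_hsieh2014_of_intHalvesOnTree_of_partner
    (hnf : exists_isNewformOf)
    (hPT : ∀ (K : Type) [Field K] [NumberField K], poitouTate_selmerStructure_duality K)
    (hPT2 : ∀ (K : Type) [Field K] [NumberField K], poitouTate_sha_tateDual K)
    (hEP : ∀ (K : Type) [Field K] [NumberField K] (v : HeightOneSpectrum (𝓞 K)),
      localEulerPoincareCharacteristic (v.adicCompletion K))
    (hcd : fieldCdLE_two_of_numberField)
    (hBr : ∀ (K : Type) [Field K] [NumberField K] (p : ℕ) [Fact p.Prime],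
      ZpExtension.decomp_not_le_kerSubgroup_of_isAnticyclotomic K p)
    (hH : hsieh2014_exists_anticyclotomicPAdicLFunction)
    (N : ℕ) [NeZero N] (K : Type) [Field K] [NumberField K]
    (Dt : ModularParametrizationData W N) (H : HeegnerDatum N (NumberField.discr K)) (ι : K →+* ℂ)
    (P : (W.baseChange K).toAffine.Point)
    (hGZ : gross_zagier N W K) (hKo : kolyvagin N W K)
    (hGZK : rank_eq_analyticRank_of_analyticRank_le_one)
    (hc : CellC W p) (hns : ¬ W.HasSplitMultiplicativeReductionAtPrime p) (hN : W.conductorNorm ℤ = N)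
    (hK : IsImaginaryQuadratic K) (hd4 : NumberField.discr K < -4)
    (hHN : SatisfiesHeegnerHypothesis N K) (hsplit : SatisfiesHeegnerHypothesis p K)
    (hP : WeierstrassCurve.Affine.Point.map ι.toRatAlgHom P = heegnerPointComplex Dt H)
    (hPinf : ¬ IsOfFinAddOrder P) (hcM : ¬ (p : ℤ) ∣ Dt.c)
    (hLt : (W.quadraticTwist (NumberField.discr K : ℚ)).entireLFunction 1 ≠ 0)
    (Wd : WeierstrassCurve ℚ) [Wd.IsElliptic] [Wd.IsGloballyMinimal] (Cd : VariableChange ℚ)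
    (hWd : Cd • W.quadraticTwist (NumberField.discr K : ℚ) = Wd) (htw : PPartRankZero Wd p)
    (htam : padicValNat p Wd.tamagawaProduct = padicValNat p W.tamagawaProduct)
    (hu : padicValRat p (Cd.u : ℚ) = 0)
    (htamK : padicValNat p (W.baseChange K).tamagawaProduct = 2 * padicValNat p W.tamagawaProduct)
    (κ : ZpExtension K p) (hκ : κ.IsAnticyclotomic) (γ : Field.absoluteGaloisGroup K)
    [Fact (κ.IsTopGenerator γ)] (𝔭 : HeightOneSpectrum (𝓞 K))
    (h𝔭 : ((p : ℕ) : 𝓞 K) ∈ 𝔭.asIdeal) (he : 𝔭.asIdeal.ramificationIdx (𝓞 ℚ) = 1)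
    (hf : 𝔭.asIdeal.inertiaDeg (𝓞 ℚ) = 1)
    (h2 : NonsplitBDPValueOnTreeInt W p) (h3 : NonsplitIMCEqOnTreeInt W p) : BSDp W p := by
  subst hN
  obtain ⟨f, hfW⟩ := hnf W
  obtain ⟨ι₀⟩ := PadicAlgCl.nonempty_ringEquiv_complex p
  obtain ⟨ι', -, hι'⟩ := X11b.exists_datum_forall_mem_iff p ι₀ hK h𝔭
  obtain ⟨ΩK, Ωp, Q, hΩK, hΩp, hQ⟩ := exists_isBDPLFunctionInt_of_hsieh2014_of_classX2 W p hH ι' 𝔭 κ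
    γ hfW hc.2 rfl hK hHN h𝔭 hι' hκ Fact.out
  exact bsdp_of_cellC_of_not_split_of_imcWaldspurgerOnTree_of_partner hnf hPT hPT2 hEP hcd hBr W p
    (W.conductorNorm ℤ) K Dt H ι P hGZ hKo hGZK hc hns rfl hK hd4 hHN hsplit hP hPinf hcM hLt Wd Cd
    hWd htw htam hu htamK κ hκ γ 𝔭 h𝔭 he hf
    (imcWaldspurgerOnTreeAt_of_intHalves_of_not_split_of_rankOne W p hGZK hnf hPT hPT2 hEP hcd hBr
      hc.2.1 hc.2.2.2 hns hc.1 hK (hsplit p Fact.out dvd_rfl) hLt P hPinf κ hκ γ 𝔭 h𝔭 he hf Q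
      (h3 (W.conductorNorm ℤ) K Dt H ι P hc hns rfl hK hd4 hHN hLt hP hcM hPinf κ hκ γ 𝔭 h𝔭 he
        hf f hfW ι' hι' ΩK Ωp Q hΩK hΩp hQ)
      (h2 (W.conductorNorm ℤ) K Dt H ι P hc hns rfl hK hd4 hHN hLt hP hcM hPinf κ hκ γ 𝔭 h𝔭 he
        hf f hfW ι' hι' ΩK Ωp Q hΩK hΩp hQ))

/-- **Either parity, with the partner's input in MAIN-CONJECTURE form — NO RESIDUAL**:
`bsdp_of_cellC_of_not_split_of_hsieh2014_of_halvesOnTree_of_mazurMainConjectureAt` (p404695) with the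
binder `hres` REMOVED and the halves read ♭; the partner's rank-zero `p`-part `PPartRankZero Wd p` is
DERIVED from `X2.MazurMainConjectureAt Wd p` (Mazur's main conjecture at the NON-split Eisenstein
`p ‖ N` for the CGLS twist `E^{d_K}`, rank `0`, X2 and non-split at `p`: `classX2_twist`) through the
published rank-zero closer `bsdp_of_mazurMainConjectureAt_of_analyticRank_eq_zero` (`X2/RankZero.lean`:
Stein–Wuthrich 6.1, canonical heights, GZK, modularity, Greenberg–Stevens) and `pPart_of_bsdp` /
`pPartRankZero_of_pPart`. So ALL of O9 ∩ {non-split} reads: {Hsieh 2014 Thm. 1, H2♭, H3♭} at `E` +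
`MazurMainConjectureAt` at the partner (needed only when ψ is odd). CONDITIONAL on every listed binder;
nothing booked; no label change. [cite: CastellaEtAl2021, Thm. 5.3.1 and its proof]
[cite: SteinWuthrich2013, Thm. 6.1] [claim: KellerYin2024, status: under-review] [cite: Miller2011LMS, Def. 1.1] -/
theorem bsdp_of_cellC_of_not_split_of_hsieh2014_of_intHalvesOnTree_of_mazurMainConjectureAt
    (hJs : thm61_splitMultiplicative) (hJn : thm61_nonsplitMultiplicative)
    (hHs : exists_isSplitMultCanonical) (hHn : exists_isMultCanonical)
    (hpar : nonempty_modularParametrizationData)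
    (hGS : ∀ (W : WeierstrassCurve ℚ) [W.IsElliptic] [W.IsGloballyMinimal] (p : ℕ) [Fact p.Prime],
      greenberg_stevens (W := W) (p := p))
    (hnf : exists_isNewformOf)
    (hPT : ∀ (K : Type) [Field K] [NumberField K], poitouTate_selmerStructure_duality K)
    (hPT2 : ∀ (K : Type) [Field K] [NumberField K], poitouTate_sha_tateDual K)
    (hEP : ∀ (K : Type) [Field K] [NumberField K] (v : HeightOneSpectrum (𝓞 K)),
      localEulerPoincareCharacteristic (v.adicCompletion K))
    (hcd : fieldCdLE_two_of_numberField)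
    (hBr : ∀ (K : Type) [Field K] [NumberField K] (p : ℕ) [Fact p.Prime],
      ZpExtension.decomp_not_le_kerSubgroup_of_isAnticyclotomic K p)
    (hH : hsieh2014_exists_anticyclotomicPAdicLFunction)
    (N : ℕ) [NeZero N] (K : Type) [Field K] [NumberField K]
    (Dt : ModularParametrizationData W N) (H : HeegnerDatum N (NumberField.discr K)) (ι : K →+* ℂ)
    (P : (W.baseChange K).toAffine.Point)
    (hGZ : gross_zagier N W K) (hKo : kolyvagin N W K)
    (hGZK : rank_eq_analyticRank_of_analyticRank_le_one)
    (hc : CellC W p) (hns : ¬ W.HasSplitMultiplicativeReductionAtPrime p) (hN : W.conductorNorm ℤ = N)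
    (hK : IsImaginaryQuadratic K) (hd4 : NumberField.discr K < -4)
    (hHN : SatisfiesHeegnerHypothesis N K) (hsplit : SatisfiesHeegnerHypothesis p K)
    (hP : WeierstrassCurve.Affine.Point.map ι.toRatAlgHom P = heegnerPointComplex Dt H)
    (hPinf : ¬ IsOfFinAddOrder P) (hcM : ¬ (p : ℤ) ∣ Dt.c)
    (hLt : (W.quadraticTwist (NumberField.discr K : ℚ)).entireLFunction 1 ≠ 0)
    (Wd : WeierstrassCurve ℚ) [Wd.IsElliptic] [Wd.IsGloballyMinimal] (Cd : VariableChange ℚ)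
    (hWd : Cd • W.quadraticTwist (NumberField.discr K : ℚ) = Wd)
    (hMC : MazurMainConjectureAt Wd p)
    (htam : padicValNat p Wd.tamagawaProduct = padicValNat p W.tamagawaProduct)
    (hu : padicValRat p (Cd.u : ℚ) = 0)
    (htamK : padicValNat p (W.baseChange K).tamagawaProduct = 2 * padicValNat p W.tamagawaProduct)
    (κ : ZpExtension K p) (hκ : κ.IsAnticyclotomic) (γ : Field.absoluteGaloisGroup K)
    [Fact (κ.IsTopGenerator γ)] (𝔭 : HeightOneSpectrum (𝓞 K))
    (h𝔭 : ((p : ℕ) : 𝓞 K) ∈ 𝔭.asIdeal) (he : 𝔭.asIdeal.ramificationIdx (𝓞 ℚ) = 1)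
    (hf : 𝔭.asIdeal.inertiaDeg (𝓞 ℚ) = 1)
    (h2 : NonsplitBDPValueOnTreeInt W p) (h3 : NonsplitIMCEqOnTreeInt W p) : BSDp W p := by
  have hmod : hasEntireLFunction_rat := hasEntireLFunction_rat_of_exists_isNewformOf hnf
  -- the partner `Wd` is a rank-zero X2 pair (non-split at `p`, though only X2-ness is used here)
  have hC : Cd⁻¹ • Wd = W.quadraticTwist (NumberField.discr K : ℚ) := by
    rw [← hWd, inv_smul_smul]
  have hXd : ClassX2 Wd p := classX2_twist W p hc.2 K hK hsplit Wd ⟨Cd⁻¹, hC⟩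
  have hLd : Wd.entireLFunction 1 ≠ 0 := by
    rw [← Wd.entireLFunction_smul Cd⁻¹, hC]
    exact hLt
  have hrd : Wd.analyticRank = 0 := analyticRank_eq_zero_of_entireLFunction_one_ne_zero hLd
  have htw : PPartRankZero Wd p :=
    pPartRankZero_of_pPart hGZK Wd p hrd
      (pPart_of_bsdp hmod hGZK Wd p (by omega)
        (bsdp_of_mazurMainConjectureAt_of_analyticRank_eq_zero hJs hJn hHs hHn hGZK hmod hpar Wd p
          (hGS Wd p) hXd.1 hXd.2.2 hrd hMC))
  exact bsdp_of_cellC_of_not_split_of_hsieh2014_of_intHalvesOnTree_of_partner W p hnf hPT hPT2 hEP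
    hcd hBr hH N K Dt H ι P hGZ hKo hGZK hc hns hN hK hd4 hHN hsplit hP hPinf hcM hLt Wd Cd hWd htw
    htam hu htamK κ hκ γ 𝔭 h𝔭 he hf h2 h3

end Assembly

end Summit.BirchSwinnertonDyer.Rank1Residual.X2

end
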